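import Mathlib
import Literature.Analysis.FluidPDE.ParticleTrajectoryFlow
import Literature.Analysis.ODE.YorkePeriodBoundProofs
import Summits.NavierStokesRegularity.NavierStokesRegularity.Theses.VortexLineClock
import HarnessLib

/-!
# `VortexLineClock.EulerClockBound` — the Euler clock theorem: periods of closed vortex lines
  are conserved by smooth Euler flows and bounded below by Yorke's constant at `t = 0`
  (route `VortexLineClock`, item stmt-NavierStokesRegularity-11279, support; card P1)

**Statement.** `T > 0`, `(u, p)` a classical unforced Euler solution on `ℝ³ × [0, T)` whose velocity
gradient is bounded on every compact sub-slab `[0, T'] ⊂ [0, T)`, `curl u(0)` globally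
`L`-Lipschitz. Then for every `t ∈ [0, T)` every closed vortex line of `ω(t) = curl u(t)` — a
`τ`-periodic solution `x` of `x' = ω(t)(x)`, `τ > 0`, through a point where `ω(t) ≠ 0` — has
`τ ≥ 2π/L`.

PROOF (every analytic input is a theorem of the tree).
1. *Particle trajectories.* The gradient bound makes `u` uniformly Lipschitz in space on compact
   time sets (`IsSmoothSpaceTimeOn.isUniformlyLipschitzOn_of_norm_fderiv_le`), so the evolution map
   `φ(t, t₀, ·)` of `u` within `S = [0, T)` exists (`Literature.Analysis.ODE.evolutionMap`), is a
   smooth bijection of `ℝ³` with smooth inverse `φ(t₀, t, ·)` (`evolutionMap_symm`,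
   `contDiff_evolutionMap_slice`).
2. *Cauchy's formula* (Majda–Bertozzi Prop. 1.8, DISCHARGED in the tree:
   `IsClassicalNSSolutionOn.curl_evolutionMap`): `ω(t)(φ(t,0,a)) = Dφ(t,0)(a) ω₀(a)`.
3. *Pull back the loop*: `y(s) = φ(0, t, x(s))` is `τ`-periodic, and by the chain rule and
   `Dφ(0,t)(x) ∘ Dφ(t,0)(y) = id` (derivative of `φ(0,t,·) ∘ φ(t,0,·) = id`),
   `y'(s) = Dφ(0,t)(x(s)) ω(t)(x(s)) = Dφ(0,t)(x(s)) Dφ(t,0)(y(s)) ω₀(y(s)) = ω₀(y(s))`: `y` is a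
   closed vortex line of `ω₀` with the SAME period; it is non-stationary because
   `ω(t)(x(0)) = Dφ(t,0)(y(0)) ω₀(y(0)) ≠ 0`.
4. *Yorke 1969* (tree: `Literature.Analysis.ODE.Yorke1969_periodBound_holds`): a non-stationary
   `τ`-periodic orbit of the `L`-Lipschitz field `ω₀` has `τ ≥ 2π/L`.

References: A. J. Majda, A. L. Bertozzi, *Vorticity and Incompressible Flow* (CUP 2002), §1.6
Props. 1.8–1.9; J. A. Yorke, Proc. AMS 22 (1969) 509–512.

HONEST FRAMING: a classical kinematic fact (vortex lines are material lines) about smooth Euler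
flows, combined with Yorke's period bound; nothing here bears on the regularity problem itself.
-/

noncomputable section

set_option linter.dupNamespace false

namespace Summit.NavierStokesRegularity.NavierStokesRegularity.Theorems

open Set Function Literature.Analysis Literature.Analysis.FluidPDE
open scoped NNReal ContDiff

namespace EulerClock

/-- A compact subset of `[0, T)` lies in some compact sub-slab `[0, T']`, `T' < T`. -/
theorem exists_subset_Icc_of_isCompact {T : ℝ} (hT : 0 < T) {C : Set ℝ} (hC : IsCompact C)
    (hCS : C ⊆ Ico 0 T) : ∃ T' < T, C ⊆ Icc 0 T' := by
  rcases C.eq_empty_or_nonempty with rfl | hne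
  · exact ⟨0, hT, by simp⟩
  · exact ⟨sSup C, (hCS (hC.sSup_mem hne)).2,
      fun s hs => ⟨(hCS hs).1, le_csSup hC.bddAbove hs⟩⟩

/-- **Cauchy–Lipschitz hypotheses from the slab gradient bound**: a classical Euler solution on
`[0, T)` whose velocity gradient is bounded on every `[0, T']`, `T' < T`, is uniformly Lipschitz in
space on compact time sets (mean value inequality;
`IsSmoothSpaceTimeOn.isUniformlyLipschitzOn_of_norm_fderiv_le`). -/
theorem isUniformlyLipschitzOn {T : ℝ} (hT : 0 < T)
    {u : ℝ → EuclideanSpace ℝ (Fin 3) → EuclideanSpace ℝ (Fin 3)}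
    {p : ℝ → EuclideanSpace ℝ (Fin 3) → ℝ} (h : IsClassicalEulerSolutionOn (Ico 0 T) 0 u p)
    (hK : ∀ T' < T, ∃ K : ℝ, ∀ t ∈ Icc 0 T', ∀ y, ‖fderiv ℝ (u t) y‖ ≤ K) :
    ODE.IsUniformlyLipschitzOn u (Ico 0 T) :=
  h.smooth_velocity.isUniformlyLipschitzOn_of_norm_fderiv_le fun C hC hCS => by
    obtain ⟨T', hT', hsub⟩ := exists_subset_Icc_of_isCompact hT hC hCS
    obtain ⟨K, hK⟩ := hK T' hT'
    exact ⟨K, fun t ht y => hK t (hsub ht) y⟩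

end EulerClock

/-- **Item `VortexLineClock.EulerClockBound` (stmt-NavierStokesRegularity-11279).** For a classical
Euler solution on `ℝ³ × [0, T)` with velocity gradient bounded on compact sub-slabs and
`curl u(0)` globally `L`-Lipschitz, every closed vortex line of `curl u(t)`, `0 ≤ t < T`, has period
`≥ 2π/L`: the inverse particle-trajectory map pulls it back to a closed vortex line of `curl u(0)`
with the same period (Cauchy's formula, Majda–Bertozzi Props. 1.8–1.9), and Yorke's theorem bounds
that period. -/
theorem vortexLineClock_eulerClockBound_proof : Theses.VortexLineClock.EulerClockBound := by
  intro T hT u p hsol hK L hL t ht x τ hτ hx hper hne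
  -- the time set and the Cauchy–Lipschitz hypotheses
  have hS : Convex ℝ (Ico (0 : ℝ) T) := convex_Ico 0 T
  have h0 : (0 : ℝ) ∈ Ico (0 : ℝ) T := ⟨le_rfl, hT⟩
  have hU : UniqueDiffOn ℝ (Ico (0 : ℝ) T) := uniqueDiffOn_Ico 0 T
  have hUL : ODE.IsUniformlyLipschitzOn u (Ico 0 T) := EulerClock.isUniformlyLipschitzOn hT hsol hK
  -- forward and backward particle-trajectory maps between the times `0` and `t`
  obtain ⟨Φ, hΦ⟩ : ∃ Φ : EuclideanSpace ℝ (Fin 3) → EuclideanSpace ℝ (Fin 3),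
      Φ = ODE.evolutionMap u 0 t := ⟨_, rfl⟩
  obtain ⟨Ψ, hΨ⟩ : ∃ Ψ : EuclideanSpace ℝ (Fin 3) → EuclideanSpace ℝ (Fin 3),
      Ψ = ODE.evolutionMap u t 0 := ⟨_, rfl⟩
  have hΨΦ : ∀ a, Ψ (Φ a) = a := fun a => by
    rw [hΦ, hΨ]; exact hUL.evolutionMap_symm hS h0 ht a
  have hΦΨ : ∀ b, Φ (Ψ b) = b := fun b => by
    rw [hΦ, hΨ]; exact hUL.evolutionMap_symm hS ht h0 b
  have hΦs : ContDiff ℝ ∞ Φ := by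
    rw [hΦ]; exact contDiff_evolutionMap_slice hUL hsol.smooth_velocity hS hU h0 ht
  have hΨs : ContDiff ℝ ∞ Ψ := by
    rw [hΨ]; exact contDiff_evolutionMap_slice hUL hsol.smooth_velocity hS hU ht h0
  have hΦd : ∀ a, HasFDerivAt Φ (fderiv ℝ Φ a) a := fun a =>
    (hΦs.differentiable (by simp) a).hasFDerivAt
  have hΨd : ∀ b, HasFDerivAt Ψ (fderiv ℝ Ψ b) b := fun b =>
    (hΨs.differentiable (by simp) b).hasFDerivAt
  -- `DΨ(Φ a) ∘ DΦ(a) = id`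
  have hcomp : ∀ a v, fderiv ℝ Ψ (Φ a) (fderiv ℝ Φ a v) = v := by
    intro a v
    have h1 : HasFDerivAt (Ψ ∘ Φ) ((fderiv ℝ Ψ (Φ a)).comp (fderiv ℝ Φ a)) a :=
      (hΨd (Φ a)).comp a (hΦd a)
    have h2 : HasFDerivAt (Ψ ∘ Φ) (ContinuousLinearMap.id ℝ (EuclideanSpace ℝ (Fin 3))) a := by
      have he : Ψ ∘ Φ = id := funext fun a => hΨΦ a
      rw [he]
      exact hasFDerivAt_id a
    have h3 := congrArg (fun f : EuclideanSpace ℝ (Fin 3) →L[ℝ] EuclideanSpace ℝ (Fin 3) => f v)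
      (h1.unique h2)
    simpa using h3
  -- Cauchy's vorticity-transport formula along the trajectories (Majda–Bertozzi Prop. 1.8)
  have hcauchy : ∀ a, curl (u t) (Φ a) = fderiv ℝ Φ a (curl (u 0) a) := fun a => by
    rw [hΦ]; exact hsol.curl_evolutionMap hS h0 hU hUL ht a
  -- the pulled-back loop `y = Ψ ∘ x`
  obtain ⟨y, hy⟩ : ∃ y : ℝ → EuclideanSpace ℝ (Fin 3), ∀ s, y s = Ψ (x s) := ⟨_, fun _ => rfl⟩
  have hxy : ∀ s, x s = Φ (y s) := fun s => by rw [hy, hΦΨ]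
  have hyd : ∀ s, HasDerivAt y (curl (u 0) (y s)) s := by
    intro s
    have h1 : HasDerivAt (Ψ ∘ x) (fderiv ℝ Ψ (x s) (curl (u t) (x s))) s :=
      (hΨd (x s)).comp_hasDerivAt s (hx s)
    have h2 : fderiv ℝ Ψ (x s) (curl (u t) (x s)) = curl (u 0) (y s) := by
      rw [hxy s, hcauchy (y s), hcomp]
    have h3 : HasDerivAt (Ψ ∘ x) (curl (u 0) (y s)) s := by rw [← h2]; exact h1
    have hyeq : y = Ψ ∘ x := funext hy
    rw [hyeq] at h3 ⊢
    exact h3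
  have hyper : Function.Periodic y τ := fun s => by rw [hy, hy, hper s]
  have hy0 : curl (u 0) (y 0) ≠ 0 := by
    intro hzero
    apply hne
    rw [hxy 0, hcauchy (y 0), hzero, map_zero]
  -- a non-stationary periodic orbit is not constant
  have hnc : ∃ t₁ t₂, y t₁ ≠ y t₂ := by
    by_contra hcon
    push Not at hcon
    have hc : y = fun _ => y 0 := funext fun s => hcon s 0
    have hd : HasDerivAt y 0 0 := by
      rw [hc]
      exact hasDerivAt_const (0 : ℝ) (y 0)
    exact hy0 ((hyd 0).unique hd)
  -- Yorke 1969
  exact ODE.Yorke1969_periodBound_holds 3 univ (curl (u 0)) L (hL.lipschitzOnWith) y τ hτ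
    (fun _ => mem_univ _) hyd hyper hnc

end Summit.NavierStokesRegularity.NavierStokesRegularity.Theorems

end
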